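import Summits.NavierStokesRegularity.FunctionalMining.PressureFunctional
import Summits.NavierStokesRegularity.FunctionalMining.GradientTransport
import HarnessLib

/-!
# FunctionalMining — the exact rate of the pressure moment `∫π²` along classical solutions

Search for candidate a priori estimates; no regularity claim. Cell `pub-nsfunc`, prove seat
(gen 10). For the row `EP.p.q=2|T_LD|G1` (pressure moment `∫|p|²`, pressure normalised to zero
mean: `torusPressureMoment 2 v = ∫ π_v²`, `π_v = Δ⁻¹(−∑ᵢⱼ∂ᵢvⱼ∂ⱼvᵢ)`, file `PressureFunctional`) this
file computes the one-sided time derivative of `s ↦ ∫ π_{u(s)}²` along every classical solution of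
the unforced Navier–Stokes equations on `T^d × [a, b]`:

`d/dt ∫ π² = 2∫ π ∂ₜπ`, `∂ₜπ = Δ⁻¹(−2∑ᵢⱼ (∂ᵢ∂ₜuⱼ)(∂ⱼuᵢ))`
(`∂ₜΔ⁻¹ = Δ⁻¹∂ₜ`, tree `Torus.timeDerivWithin_invLaplacian`), and with the gradient transport
identity `∂ₜ∂ᵢuⱼ = ν∂ᵢ(Δu)ⱼ − ∂ᵢ∂ⱼp − ∑ₖ∂ᵢuₖ∂ₖuⱼ − ∑ₖuₖ∂ₖ∂ᵢuⱼ`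
(`GradientTensor.timeDerivWithin_partialDeriv_apply`, Majda–Bertozzi (1.29)) the rate splits as
`N₂(u) + ν V₂(u)` with the VISCOUS (heat-flow) rate

`V₂(v) = ∫ 2π_v · Δ⁻¹(−2∑ᵢⱼ ∂ᵢ(Δv)ⱼ ∂ⱼvᵢ)` (`pressureSqViscousRate`)

and an inertial rate `N₂` (`pressureSqInertialRate`). Packaged as `HasInitialRate` for the heat
sieve (`HeatSieve`: a `T_LD` law forces `V₂ ≤ 0` at every datum). Identities along smooth solutions
only.
-/

noncomputable section

open MeasureTheory Finset Set Filter Topology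
open scoped InnerProductSpace RealInnerProductSpace ContDiff

namespace Summit.NavierStokesRegularity.FunctionalMining

open Literature.Analysis.FunctionSpaces Literature.Analysis.FluidPDE

variable {d : Type*} [Fintype d] [DecidableEq d]

/-! ## 1. The two rates -/

/-- The viscous source `A_v := −2∑ᵢⱼ ∂ᵢ(Δv)ⱼ ∂ⱼvᵢ` (the `ν`-coefficient of `∂ₜ(−s_u)`). [ours; bookkeeping] -/
def pressureSqViscousSource (v : UnitAddTorus d → EuclideanSpace ℝ d) (x : UnitAddTorus d) : ℝ :=
  -2 * ∑ i, ∑ j, Torus.partialDeriv i (Torus.laplacian v) x j * Torus.partialDeriv j v x i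

/-- The inertial source `B_v := −2∑ᵢⱼ (−∂ᵢ∂ⱼπ_v − ∑ₖ∂ᵢvₖ∂ₖvⱼ − ∑ₖvₖ∂ₖ∂ᵢvⱼ) ∂ⱼvᵢ` (the
`ν`-free part of `∂ₜ(−s_u)`). [ours; bookkeeping] -/
def pressureSqInertialSource (v : UnitAddTorus d → EuclideanSpace ℝ d) (x : UnitAddTorus d) : ℝ :=
  -2 * ∑ i, ∑ j, (-Torus.partialDeriv i (Torus.partialDeriv j (pressureOf v)) x -
      (∑ k, Torus.partialDeriv i v x k * Torus.partialDeriv k v x j) -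
      ∑ k, v x k * Torus.partialDeriv k (Torus.partialDeriv i v) x j) * Torus.partialDeriv j v x i

/-- **Viscous (heat-flow) rate of `∫π²`**: `V₂(v) = ∫ 2π_v · Δ⁻¹A_v`. [ours; bookkeeping] -/
def pressureSqViscousRate (v : UnitAddTorus d → EuclideanSpace ℝ d) : ℝ :=
  ∫ x, 2 * pressureOf v x * Torus.invLaplacian (pressureSqViscousSource v) x

/-- **Inertial rate of `∫π²`**: `N₂(v) = ∫ 2π_v · Δ⁻¹B_v`. [ours; bookkeeping] -/
def pressureSqInertialRate (v : UnitAddTorus d → EuclideanSpace ℝ d) : ℝ :=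
  ∫ x, 2 * pressureOf v x * Torus.invLaplacian (pressureSqInertialSource v) x

/-! ## 2. Smoothness -/

/-- `A_v` is smooth. [folklore] -/
theorem isSmooth_pressureSqViscousSource {v : UnitAddTorus d → EuclideanSpace ℝ d}
    (hv : Torus.IsSmooth v) : Torus.IsSmooth (pressureSqViscousSource v) := by
  have h : Torus.IsSmooth (fun x => ∑ i, ∑ j, Torus.partialDeriv i (Torus.laplacian v) x j *
      Torus.partialDeriv j v x i) :=
    ContDiff.sum fun i _ => ContDiff.sum fun j _ =>
      ((hv.laplacian.partialDeriv i).apply j).mul ((hv.partialDeriv j).apply i)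
  exact contDiff_const.mul h

/-- `B_v` is smooth. [folklore] -/
theorem isSmooth_pressureSqInertialSource {v : UnitAddTorus d → EuclideanSpace ℝ d}
    (hv : Torus.IsSmooth v) : Torus.IsSmooth (pressureSqInertialSource v) := by
  have hπ : Torus.IsSmooth (pressureOf v) := isSmooth_pressureOf hv
  have h1 : ∀ i j, Torus.IsSmooth (fun x => Torus.partialDeriv i (Torus.partialDeriv j (pressureOf v)) x) :=
    fun i j => (hπ.partialDeriv j).partialDeriv i
  have h2 : ∀ i j, Torus.IsSmooth
      (fun x => ∑ k, Torus.partialDeriv i v x k * Torus.partialDeriv k v x j) :=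
    fun i j => ContDiff.sum fun k _ => ((hv.partialDeriv i).apply k).mul ((hv.partialDeriv k).apply j)
  have h3 : ∀ i j, Torus.IsSmooth
      (fun x => ∑ k, v x k * Torus.partialDeriv k (Torus.partialDeriv i v) x j) :=
    fun i j => ContDiff.sum fun k _ => (hv.apply k).mul (((hv.partialDeriv i).partialDeriv k).apply j)
  have h : Torus.IsSmooth (fun x => ∑ i, ∑ j,
      (-Torus.partialDeriv i (Torus.partialDeriv j (pressureOf v)) x -
        (∑ k, Torus.partialDeriv i v x k * Torus.partialDeriv k v x j) -
        ∑ k, v x k * Torus.partialDeriv k (Torus.partialDeriv i v) x j) * Torus.partialDeriv j v x i) :=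
    ContDiff.sum fun i _ => ContDiff.sum fun j _ =>
      (((h1 i j).neg.sub (h2 i j)).sub (h3 i j)).mul ((hv.partialDeriv j).apply i)
  exact contDiff_const.mul h

/-! ## 3. Partial derivatives of functions differing by a constant -/

omit [Fintype d] in
/-- `∂ₖ(f − c) = ∂ₖf`. [folklore] -/
theorem partialDeriv_fun_sub_const {F : Type*} [NormedAddCommGroup F] [NormedSpace ℝ F]
    (f : UnitAddTorus d → F) (c : F) (k : d) (x : UnitAddTorus d) :
    Torus.partialDeriv k (fun y => f y - c) x = Torus.partialDeriv k f x := by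
  unfold Torus.partialDeriv Torus.lineDeriv
  simp only [deriv_sub_const]

/-! ## 4. The exact rate along classical solutions -/

/-- **`d/dt ∫π² = N₂ + νV₂` along classical unforced solutions on `T^d`.** For a classical solution
`(u, p)` of the unforced Navier–Stokes equations on `T^d × [a, b]` (`a < b`), `s ↦ ∫ π_{u(s)}²`
(`= torusPressureMoment 2 (u s)`) has, at every `t ∈ [a, b]`, the one-sided derivative
`pressureSqInertialRate (u t) + ν · pressureSqViscousRate (u t)` within `[a, b]`. [ours] -/
theorem hasDerivWithinAt_torusPressureMoment_two [Nonempty d] {a b ν : ℝ}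
    {u : ℝ → UnitAddTorus d → EuclideanSpace ℝ d} {p : ℝ → UnitAddTorus d → ℝ}
    (h : Torus.IsClassicalNSSolutionOn (Icc a b) ν 0 u p) (hab : a < b) {t : ℝ} (ht : t ∈ Icc a b) :
    HasDerivWithinAt (fun s => torusPressureMoment 2 (u s))
      (pressureSqInertialRate (u t) + ν * pressureSqViscousRate (u t)) (Icc a b) t := by
  have hU : UniqueDiffOn ℝ (Icc a b) := uniqueDiffOn_Icc hab
  have hint : (interior (Icc a b)).Nonempty := by
    rw [interior_Icc]; exact nonempty_Ioo.2 hab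
  have hu : Torus.IsSmoothSpaceTimeOn (Icc a b) u := h.smooth_velocity
  have hut : Torus.IsSmooth (u t) := hu.isSmooth_slice ht
  have hpt : Torus.IsSmooth (p t) := h.smooth_pressure.isSmooth_slice ht
  -- the source `σ(s) = −s_{u(s)}` is jointly smooth
  have hσ : Torus.IsSmoothSpaceTimeOn (Icc a b) (fun s x => -gradSqTrace (u s) x) := by
    have h1 : Torus.IsSmoothSpaceTimeOn (Icc a b) (fun s x => gradSqTrace (u s) x) :=
      Torus.IsSmoothSpaceTimeOn.sum fun i _ => Torus.IsSmoothSpaceTimeOn.sum fun j _ =>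
        ((hu.partialDeriv hU i).apply j).mul ((hu.partialDeriv hU j).apply i)
    exact h1.neg
  -- `Π(s) = π_{u(s)}` is jointly smooth
  have hP : Torus.IsSmoothSpaceTimeOn (Icc a b) (fun s => pressureOf (u s)) :=
    hσ.invLaplacian (convex_Icc a b) hint
  -- rewrite the functional as `∫ Π²`
  have hF : (fun s => torusPressureMoment 2 (u s)) = fun s => ∫ x, pressureOf (u s) x * pressureOf (u s) x := by
    funext s
    rw [torusPressureMoment_two]
    exact integral_congr_ae (ae_of_all _ fun x => by ring)
  rw [hF]
  have hθ : Torus.IsSmoothSpaceTimeOn (Icc a b) (fun s x => pressureOf (u s) x * pressureOf (u s) x) :=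
    hP.mul hP
  have hD := hθ.hasDerivWithinAt_integral (convex_Icc a b) ht
  refine hD.congr_deriv ?_
  -- pointwise: `∂ₜ(Π²) = 2Π ∂ₜΠ` and `∂ₜΠ = Δ⁻¹(∂ₜσ)`
  have hslice : ∀ x, Torus.timeDerivWithin (Icc a b)
      (fun s y => pressureOf (u s) y * pressureOf (u s) y) t x =
      2 * pressureOf (u t) x * Torus.invLaplacian
        (Torus.timeDerivWithin (Icc a b) (fun s y => -gradSqTrace (u s) y) t) x := by
    intro x
    have h1 := hP.hasDerivWithinAt_slice ht x
    have h2 := h1.fun_mul h1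
    have e3 : Torus.timeDerivWithin (Icc a b) (fun s => pressureOf (u s)) t x =
        Torus.invLaplacian (Torus.timeDerivWithin (Icc a b) (fun s y => -gradSqTrace (u s) y) t) x :=
      Torus.timeDerivWithin_invLaplacian hab hσ ht x
    rw [Torus.timeDerivWithin, h2.derivWithin (hU t ht), e3]
    ring
  -- the time derivative of the source: `∂ₜ(−s) = ν A + B`
  have hsrc : Torus.timeDerivWithin (Icc a b) (fun s y => -gradSqTrace (u s) y) t =
      fun x => ν * pressureSqViscousSource (u t) x + pressureSqInertialSource (u t) x := by
    funext x
    -- derivative of each entry `∂ᵢuⱼ`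
    have hD : ∀ i j, HasDerivWithinAt (fun s => Torus.partialDeriv i (u s) x j)
        (Torus.partialDeriv i (Torus.timeDerivWithin (Icc a b) u t) x j) (Icc a b) t :=
      fun i j => GradientTensor.hasDerivWithinAt_partialDeriv_apply h hab ht i j x
    have hval : ∀ i j, Torus.partialDeriv i (Torus.timeDerivWithin (Icc a b) u t) x j =
        ν * Torus.partialDeriv i (Torus.laplacian (u t)) x j -
          Torus.partialDeriv i (Torus.partialDeriv j (p t)) x -
          (∑ k, Torus.partialDeriv i (u t) x k * Torus.partialDeriv k (u t) x j) -
          ∑ k, u t x k * Torus.partialDeriv k (Torus.partialDeriv i (u t)) x j := by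
      intro i j
      have e := GradientTensor.timeDerivWithin_partialDeriv_apply h hab ht i j x
      rw [Torus.timeDerivWithin, (hD i j).derivWithin (hU t ht)] at e
      rw [e]
      have h0 : Torus.partialDeriv i ((0 : ℝ → UnitAddTorus d → EuclideanSpace ℝ d) t) x j = 0 := by
        simp [Torus.partialDeriv, Torus.lineDeriv]
      rw [h0, add_zero]
    -- `∂ᵢ∂ⱼ p = ∂ᵢ∂ⱼ π`
    have hpp : ∀ i j, Torus.partialDeriv i (Torus.partialDeriv j (p t)) x =
        Torus.partialDeriv i (Torus.partialDeriv j (pressureOf (u t))) x := by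
      intro i j
      rw [pressureOf_eq_pressure_sub_integral h hab ht]
      congr 1
      funext y
      exact (partialDeriv_fun_sub_const (p t) _ j y).symm
    -- the derivative of `−s = −∑ᵢⱼ ∂ᵢuⱼ ∂ⱼuᵢ`
    have hsum : HasDerivWithinAt (fun s => -gradSqTrace (u s) x)
        (-(∑ i, ∑ j, (Torus.partialDeriv i (Torus.timeDerivWithin (Icc a b) u t) x j *
          Torus.partialDeriv j (u t) x i +
          Torus.partialDeriv i (u t) x j *
            Torus.partialDeriv j (Torus.timeDerivWithin (Icc a b) u t) x i))) (Icc a b) t := by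
      have := HasDerivWithinAt.fun_sum (u := Finset.univ) fun i _ =>
        HasDerivWithinAt.fun_sum (u := Finset.univ) fun j _ => (hD i j).fun_mul (hD j i)
      exact this.neg
    rw [Torus.timeDerivWithin, hsum.derivWithin (hU t ht)]
    -- symmetrise the second half of the sum
    have hswap : ∑ i, ∑ j, Torus.partialDeriv i (u t) x j *
        Torus.partialDeriv j (Torus.timeDerivWithin (Icc a b) u t) x i =
        ∑ i, ∑ j, Torus.partialDeriv i (Torus.timeDerivWithin (Icc a b) u t) x j *
          Torus.partialDeriv j (u t) x i := by
      rw [Finset.sum_comm]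
      exact Finset.sum_congr rfl fun i _ => Finset.sum_congr rfl fun j _ => by ring
    -- substitute the transport identity entrywise
    have hDG : ∀ i j, Torus.partialDeriv i (Torus.timeDerivWithin (Icc a b) u t) x j *
        Torus.partialDeriv j (u t) x i =
        ν * (Torus.partialDeriv i (Torus.laplacian (u t)) x j * Torus.partialDeriv j (u t) x i) +
          (-Torus.partialDeriv i (Torus.partialDeriv j (pressureOf (u t))) x -
            (∑ k, Torus.partialDeriv i (u t) x k * Torus.partialDeriv k (u t) x j) -
            ∑ k, u t x k * Torus.partialDeriv k (Torus.partialDeriv i (u t)) x j) *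
            Torus.partialDeriv j (u t) x i := by
      intro i j
      rw [hval i j, hpp i j]
      ring
    simp only [Finset.sum_add_distrib, hswap]
    simp only [hDG, Finset.sum_add_distrib, ← Finset.mul_sum]
    simp only [pressureSqViscousSource, pressureSqInertialSource]
    ring
  simp_rw [hslice]
  rw [hsrc]
  -- split `Δ⁻¹(νA + B) = ν Δ⁻¹A + Δ⁻¹B` and integrate
  have hA : Torus.IsSmooth (pressureSqViscousSource (u t)) := isSmooth_pressureSqViscousSource hut
  have hB : Torus.IsSmooth (pressureSqInertialSource (u t)) := isSmooth_pressureSqInertialSource hut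
  have hπ : Torus.IsSmooth (pressureOf (u t)) := isSmooth_pressureOf hut
  have hsplit : Torus.invLaplacian (fun x => ν * pressureSqViscousSource (u t) x +
      pressureSqInertialSource (u t) x) =
      fun x => ν * Torus.invLaplacian (pressureSqViscousSource (u t)) x +
        Torus.invLaplacian (pressureSqInertialSource (u t)) x := by
    have e1 : (fun x => ν * pressureSqViscousSource (u t) x + pressureSqInertialSource (u t) x) =
        (ν • pressureSqViscousSource (u t)) + pressureSqInertialSource (u t) := by
      funext x; simp [smul_eq_mul]
    have hνA : Torus.IsSmooth (ν • pressureSqViscousSource (u t)) := hA.const_smul ν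
    rw [e1, Torus.invLaplacian_add hνA hB, Torus.invLaplacian_const_smul ν _ hA]
    funext x; simp [smul_eq_mul]
  rw [hsplit]
  have hπc : Continuous (fun x => 2 * pressureOf (u t) x) := continuous_const.mul hπ.continuous
  have iA : Integrable (fun x => ν * (2 * pressureOf (u t) x *
      Torus.invLaplacian (pressureSqViscousSource (u t)) x)) :=
    ((hπc.mul (Torus.isSmooth_invLaplacian hA).continuous).integrable_unitAddTorus).const_mul ν
  have iB : Integrable (fun x => 2 * pressureOf (u t) x *
      Torus.invLaplacian (pressureSqInertialSource (u t)) x) :=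
    (hπc.mul (Torus.isSmooth_invLaplacian hB).continuous).integrable_unitAddTorus
  have e2 : ∀ x, 2 * pressureOf (u t) x * (ν * Torus.invLaplacian (pressureSqViscousSource (u t)) x +
      Torus.invLaplacian (pressureSqInertialSource (u t)) x) =
      ν * (2 * pressureOf (u t) x * Torus.invLaplacian (pressureSqViscousSource (u t)) x) +
        2 * pressureOf (u t) x * Torus.invLaplacian (pressureSqInertialSource (u t)) x := by
    intro x; ring
  simp_rw [e2]
  rw [integral_add iA iB, integral_const_mul, pressureSqViscousRate, pressureSqInertialRate]
  ring

/-- **The initial rates of the row `EP.p.q=2`**: `HasInitialRate (torusPressureMoment 2) N₂ V₂` on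
`T³` — along every zero-mean classical solution of unforced Navier–Stokes, at the initial time,
`d/dt ∫π² = N₂(u₀) + ν V₂(u₀)`. [ours] -/
theorem hasInitialRate_torusPressureMoment_two :
    HasInitialRate (d := d) (torusPressureMoment 2) pressureSqInertialRate pressureSqViscousRate := by
  intro hd ν _ a b hab u p hsol _
  haveI : Nonempty d := Fintype.card_pos_iff.mp (by omega)
  exact hasDerivWithinAt_torusPressureMoment_two hsol hab (left_mem_Icc.2 hab.le)

end Summit.NavierStokesRegularity.FunctionalMining
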